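import Mathlib.Combinatorics.Additive.ApproximateSubgroup
import Mathlib.LinearAlgebra.Matrix.SpecialLinearGroup
import Mathlib.Analysis.SpecialFunctions.Pow.Real

/-!
# The product theorem in `SL₂` over a finite field (Breuillard–Green–Tao 2011, Main theorem, `𝔾 = SL₂`)

Topic `Literature/GroupTheory/ApproximateGroups`.  One DEFINITION (control, with two proved unfolding
lemmas), one NAMED FACT (not proved here), and two proved corollaries of the fact in Mathlib's
vocabulary.

## Source and numbering

E. Breuillard, B. Green, T. Tao, *Approximate subgroups of linear groups*, Geom. Funct. Anal. **21**
(2011) 774–819, arXiv:1005.1881 [BreuillardGreenTao2011].  Numbering below is that of arXiv:1005.1881v1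
(the only arXiv version; checked on the LaTeX source, whose theorem environments share the
`subsection` counter): **Definition 1.1** (approximate subgroups), **Definition 1.2** (control),
**Theorem 2.3** ("Main theorem", `\label{mainthm2}`; the first theorem of the paper that is not
Helfgott's — it is sometimes quoted as "Theorem 1.3"), proved in §5 from the more precise Theorem 5.5.

* Definition 1.1. `K ≥ 1`. A nonempty finite set `A` in a group `G` is a `K`-approximate subgroup of
  `G` if (i) it is a symmetric subset of `G`, "by which we mean that if `a ∈ A` then `a⁻¹ ∈ A`, and that
  the identity lies in `A`", and (ii) there is a SYMMETRIC subset `X ⊆ G` with `|X| ≤ K` such that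
  `A·A ⊆ X·A`.  ("For the rest of the paper we will assume that `K ≥ 2`.")  We read "symmetric" for `X`
  as for `A` (closed under inverses and containing the identity) — requiring more of `X` only weakens
  the hypothesis of the fact below, and a cover can always be enlarged by `1`.
* Definition 1.2. `A` is `K`-controlled by `B` if `|B| ≤ K|A|` and there is a set `X` in the ambient
  group with `|X| ≤ K` and `A ⊆ (X·B) ∩ (B·X)`.  (`IsControlledBy` below.)
* Theorem 2.3 (Main theorem). Let `k` be a finite field and `𝔾` an absolutely almost simple algebraic
  group defined over `k`.  Suppose that `A ⊆ 𝔾(k)` is a `K`-approximate subgroup that generates `𝔾(k)`.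
  Then `A` is `K^{C_{dim 𝔾}}`-controlled by either `{id}` or by `𝔾(k)` itself.  (Remark after it: the
  constant does not depend on `k`; "this theorem can be applied with `𝔾 = SL_d` for any fixed `d`, and
  the constants now only depend on `d`.")  Independently: Pyber–Szabó (J. AMS 29 (2016), arXiv:1001.4556)
  for all finite simple groups of Lie type of bounded rank; `SL₂(𝔽_p)`: Helfgott (Ann. Math. 2008) =
  Theorem 2.2 of the source; `SL₂(𝔽_q)`: Dinai.

## What is here

* `IsControlledBy K A B` — Definition 1.2 for finite sets `A B` of a group, with the two unfoldings
  used by the theorem: controlled by `{1}` iff `|A| ≤ K` (`isControlledBy_singleton_one_iff`), controlled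
  by the whole (finite) group iff `|G| ≤ K|A|` (`isControlledBy_univ_iff`).
* `BreuillardGreenTao2011_SL2 : Prop` — Theorem 2.3 for `𝔾 = SL₂` (an absolutely almost simple
  algebraic group of dimension `3`, so the exponent is an ABSOLUTE constant), stated with the
  hypotheses of Definition 1.1 written out (including the symmetric cover `X`) and the conclusion in
  terms of `IsControlledBy`.  We take the exponent `C : ℕ` (harmless: `K ≥ 2` and control is monotone
  in its parameter, so any real exponent may be rounded up) and the field in `Type` (universe `0`, as
  in the consumers' files; every finite field is isomorphic to some `GaloisField p n : Type`).
  NAMED FACT — the proof (Larsen–Pink-type non-concentration, §§3–5 of the source, or Pyber–Szabó) is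
  far beyond a file; users take `(h : BreuillardGreenTao2011_SL2)`.
* `BreuillardGreenTao2011_SL2.card_dichotomy` / `.card_dichotomy_rpow` — PROVED from the fact: for
  Mathlib's `IsApproximateSubgroup K A` (which asks `1 ∈ A`, `A⁻¹ = A` and a cover `A² ⊆ X • A` by
  `|X| ≤ K` translates WITHOUT requiring `X` symmetric or `1 ∈ X`) and `A` generating `SL₂(F)`:
  `|A| ≤ K^C` or `|SL₂(F)| ≤ K^C |A|`.  Bridge: `X ∪ X⁻¹ ∪ {1}` is a symmetric cover of size
  `≤ 2K + 1`, and `(2K+1)^C ≤ K^{3C}` for `K ≥ 2`; so Mathlib's (formally weaker) hypothesis costs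
  only the unnamed constant.  The `rpow` form is the shape requested by the `MatrixMultiplication`
  consumers (`∃ C : ℝ, 0 < C ∧ …`).

## What is NOT here

The general `𝔾` (needs "absolutely almost simple algebraic group over `k`" and `dim 𝔾`), the precise
form Theorem 5.5 (bounded-complexity Zariski-denseness instead of generation; infinite fields),
Helfgott's Theorems 2.1/2.2, Corollary 2.4 (the `|A³| ≥ |A|^{1+ε}` growth form), and any value of the
constant (the source's `C` is ineffective in places, cf. its §5 and Appendix A).
-/

namespace Literature.GroupTheory.ApproximateGroups

open scoped Pointwise MatrixGroups

section Control

variable {G : Type*} [Group G]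

/-- **Control** (Breuillard–Green–Tao, Definition 1.2; the notion goes back to Tao's "Freiman's theorem
for solvable groups").  For finite sets `A, B` of a group and a parameter `K`: `A` is `K`-controlled by
`B` (equivalently, `B` `K`-controls `A`) if `|B| ≤ K|A|` and there is a finite set `X` in the ambient
group with `|X| ≤ K` and `A ⊆ (X·B) ∩ (B·X)`.  (The source takes `K ≥ 1`; `X` finite is forced by
`|X| ≤ K`.) [cite: BreuillardGreenTao2011, Definition 1.2] -/
def IsControlledBy (K : ℝ) (A B : Finset G) : Prop :=
  (B.card : ℝ) ≤ K * A.card ∧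
    ∃ X : Finset G, (X.card : ℝ) ≤ K ∧ (↑A : Set G) ⊆ ↑X * ↑B ∧ (↑A : Set G) ⊆ ↑B * ↑X

/-- Unfolding of control by the trivial group: a nonempty `A` is `K`-controlled by `{1}` iff `|A| ≤ K`
(`A ⊆ X·{1} = X` forces `|A| ≤ |X| ≤ K`; conversely take `X = A`).
[cite: BreuillardGreenTao2011, Definition 1.2] -/
theorem isControlledBy_singleton_one_iff {K : ℝ} (hK : 1 ≤ K) {A : Finset G} (hA : A.Nonempty) :
    IsControlledBy K A {1} ↔ (A.card : ℝ) ≤ K := by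
  constructor
  · rintro ⟨-, X, hX, hAX, -⟩
    have h1 : (↑A : Set G) ⊆ ↑X := by simpa using hAX
    have h2 : A ⊆ X := Finset.coe_subset.mp h1
    calc (A.card : ℝ) ≤ X.card := by exact_mod_cast Finset.card_le_card h2
      _ ≤ K := hX
  · intro h
    refine ⟨?_, A, h, ?_, ?_⟩
    · have h1 : (1 : ℝ) ≤ A.card := by exact_mod_cast hA.card_pos
      simp only [Finset.card_singleton, Nat.cast_one]
      nlinarith
    · simp
    · simp

/-- Unfolding of control by the whole finite group: `A` is `K`-controlled by `G` iff `|G| ≤ K|A|`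
(the covering condition `A ⊆ X·G ∩ G·X` holds with `X = {1}` as soon as `K ≥ 1`).
[cite: BreuillardGreenTao2011, Definition 1.2] -/
theorem isControlledBy_univ_iff [Fintype G] {K : ℝ} (hK : 1 ≤ K) {A : Finset G} :
    IsControlledBy K A Finset.univ ↔ (Fintype.card G : ℝ) ≤ K * A.card := by
  constructor
  · rintro ⟨h, -⟩
    simpa using h
  · intro h
    refine ⟨by simpa using h, {1}, by simpa using hK, ?_, ?_⟩
    · simp
    · simp

/-- Control is monotone in the parameter. [cite: BreuillardGreenTao2011, Definition 1.2] -/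
theorem IsControlledBy.mono {K L : ℝ} (hKL : K ≤ L) {A B : Finset G} (h : IsControlledBy K A B) :
    IsControlledBy L A B := by
  obtain ⟨hB, X, hX, h1, h2⟩ := h
  refine ⟨hB.trans ?_, X, hX.trans hKL, h1, h2⟩
  exact mul_le_mul_of_nonneg_right hKL (Nat.cast_nonneg _)

end Control

/-- **Breuillard–Green–Tao 2011, Main theorem (Theorem 2.3 of arXiv:1005.1881v1 = GAFA 21 (2011)
774–819), for `𝔾 = SL₂` over a finite field.**  There is an absolute constant `C` such that for every
finite field `F`, every `K ≥ 2` and every `K`-approximate subgroup `A ⊆ SL₂(F)` in the sense of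
Definition 1.1 of the source — `1 ∈ A`, `A` closed under inverses, and `A·A ⊆ X·A` for some
SYMMETRIC `X ⊆ SL₂(F)` (closed under inverses and containing `1`) with `|X| ≤ K` — which generates
`SL₂(F)` as a group, `A` is `K^C`-controlled
(Definition 1.2, `IsControlledBy`) either by `{1}` or by `SL₂(F)` itself.  (`SL₂` is an absolutely
almost simple algebraic group defined over every field, of dimension `3`, so the source's
`C_{dim 𝔾}` is absolute; exponent taken in `ℕ`, field in `Type`, see the module docstring.)
Equivalent cardinality form: `|A| ≤ K^C` or `|A| ≥ |SL₂(F)|/K^C` (`card_dichotomy`).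
Independently proved by Pyber–Szabó (arXiv:1001.4556); for prime fields this is Helfgott's theorem
(Theorem 2.2 of the source).  NAMED FACT, not proved in the tree.
[cite: BreuillardGreenTao2011, Theorem 2.3] -/
def BreuillardGreenTao2011_SL2 : Prop :=
  ∃ C : ℕ, ∀ (F : Type) [Field F] [Fintype F] [DecidableEq F] (K : ℝ), 2 ≤ K →
    ∀ A : Finset SL(2, F),
      (1 : SL(2, F)) ∈ A →
      (∀ a ∈ A, a⁻¹ ∈ A) →
      (∃ X : Finset SL(2, F), (X.card : ℝ) ≤ K ∧ (1 : SL(2, F)) ∈ X ∧ (∀ x ∈ X, x⁻¹ ∈ X) ∧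
          (↑A * ↑A : Set SL(2, F)) ⊆ ↑X * ↑A) →
      Subgroup.closure (↑A : Set SL(2, F)) = ⊤ →
      IsControlledBy (K ^ C) A {1} ∨ IsControlledBy (K ^ C) A Finset.univ

namespace BreuillardGreenTao2011_SL2

/-- `(2K+1)^C ≤ K^{3C}` for `K ≥ 2` (`K³ − 2K − 1 = (K − 2)(K² + 2K + 2) + 3`); private arithmetic
helper. [folklore] -/
private theorem two_mul_add_one_pow_le {K : ℝ} (hK : 2 ≤ K) (C : ℕ) :
    (2 * K + 1) ^ C ≤ K ^ (3 * C) := by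
  have h2K : 2 * K + 1 ≤ K ^ 3 := by
    have hid : K ^ 3 - (2 * K + 1) = (K - 2) * (K ^ 2 + 2 * K + 2) + 3 := by ring
    nlinarith [mul_nonneg (sub_nonneg.mpr hK) (by positivity : (0 : ℝ) ≤ K ^ 2 + 2 * K + 2)]
  calc (2 * K + 1) ^ C ≤ (K ^ 3) ^ C := pow_le_pow_left₀ (by linarith) h2K C
    _ = K ^ (3 * C) := by rw [pow_mul]

/-- **Cardinality form of the product theorem for Mathlib's `IsApproximateSubgroup`** (consequence of
`BreuillardGreenTao2011_SL2`): there is an absolute `C : ℕ` such that for every finite field `F`, every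
`K ≥ 2` and every finite `A ⊆ SL₂(F)` with `IsApproximateSubgroup K A` generating `SL₂(F)`, either
`|A| ≤ K^C` or `|SL₂(F)| ≤ K^C · |A|`.  Mathlib's notion does not ask the covering set `X` to be
symmetric or to contain `1`; `X ∪ X⁻¹ ∪ {1}` is such a cover, of size `≤ 2K + 1`, and
`(2K+1)^C ≤ K^{3C}`. [cite: BreuillardGreenTao2011, Theorem 2.3] -/
theorem card_dichotomy (h : BreuillardGreenTao2011_SL2) :
    ∃ C : ℕ, ∀ (F : Type) [Field F] [Fintype F] [DecidableEq F] (K : ℝ), 2 ≤ K →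
      ∀ A : Finset SL(2, F), IsApproximateSubgroup K (↑A : Set SL(2, F)) →
        Subgroup.closure (↑A : Set SL(2, F)) = ⊤ →
        (A.card : ℝ) ≤ K ^ C ∨ (Fintype.card SL(2, F) : ℝ) ≤ K ^ C * A.card := by
  obtain ⟨C, hC⟩ := h
  refine ⟨3 * C, ?_⟩
  intro F _ _ _ K hK A hA hgen
  classical
  obtain ⟨X, hXK, hX⟩ := hA.sq_covBySMul
  have hA1 : (1 : SL(2, F)) ∈ A := by exact_mod_cast hA.one_mem
  have hAsymm : ∀ a ∈ A, a⁻¹ ∈ A := by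
    intro a ha
    have h1 : a⁻¹ ∈ (↑A : Set SL(2, F))⁻¹ := Set.inv_mem_inv.mpr (by exact_mod_cast ha)
    rw [hA.inv_eq_self] at h1
    exact_mod_cast h1
  set X' : Finset SL(2, F) := insert 1 (X ∪ X⁻¹) with hX'
  have hX'card : (X'.card : ℝ) ≤ 2 * K + 1 := by
    have h1 : X'.card ≤ (X ∪ X⁻¹).card + 1 := Finset.card_insert_le _ _
    have h2 : (X ∪ X⁻¹).card ≤ X.card + X⁻¹.card := Finset.card_union_le _ _
    have h3 : X⁻¹.card ≤ X.card := Finset.card_inv_le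
    have h4 : (X'.card : ℝ) ≤ X.card + X.card + 1 := by
      exact_mod_cast h1.trans (by omega)
    linarith
  have hX'one : (1 : SL(2, F)) ∈ X' := Finset.mem_insert_self _ _
  have hX'symm : ∀ x ∈ X', x⁻¹ ∈ X' := by
    intro x hx
    rcases Finset.mem_insert.mp hx with rfl | hx
    · rw [inv_one]
      exact hX'one
    refine Finset.mem_insert_of_mem ?_
    rcases Finset.mem_union.mp hx with hx | hx
    · exact Finset.mem_union.mpr (Or.inr (Finset.inv_mem_inv hx))
    · obtain ⟨b, hb, rfl⟩ := Finset.mem_inv.mp hx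
      rw [inv_inv]
      exact Finset.mem_union.mpr (Or.inl hb)
  have hcover : (↑A * ↑A : Set SL(2, F)) ⊆ ↑X' * ↑A := by
    have h1 : (↑A * ↑A : Set SL(2, F)) ⊆ ↑X * ↑A := by
      rw [sq] at hX
      exact hX
    refine h1.trans (Set.mul_subset_mul_right ?_)
    rw [hX', Finset.coe_insert, Finset.coe_union]
    exact Set.subset_union_left.trans (Set.subset_insert _ _)
  have h2K : (2 : ℝ) ≤ 2 * K + 1 := by linarith
  have h1le : (1 : ℝ) ≤ (2 * K + 1) ^ C := one_le_pow₀ (by linarith)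
  have hpow : (2 * K + 1) ^ C ≤ K ^ (3 * C) := two_mul_add_one_pow_le hK C
  rcases hC F (2 * K + 1) h2K A hA1 hAsymm ⟨X', hX'card, hX'one, hX'symm, hcover⟩ hgen with hc | hc
  · left
    have h1 := (isControlledBy_singleton_one_iff h1le ⟨1, hA1⟩).mp hc
    exact h1.trans hpow
  · right
    have h1 := (isControlledBy_univ_iff h1le).mp hc
    exact h1.trans (mul_le_mul_of_nonneg_right hpow (Nat.cast_nonneg _))

/-- The same cardinality dichotomy with a real exponent `C > 0` (`K ^ C` = `Real.rpow`), the shape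
used by the `MatrixMultiplication` consumers. [cite: BreuillardGreenTao2011, Theorem 2.3] -/
theorem card_dichotomy_rpow (h : BreuillardGreenTao2011_SL2) :
    ∃ C : ℝ, 0 < C ∧ ∀ (F : Type) [Field F] [Fintype F] [DecidableEq F] (K : ℝ), 2 ≤ K →
      ∀ A : Finset SL(2, F), IsApproximateSubgroup K (↑A : Set SL(2, F)) →
        Subgroup.closure (↑A : Set SL(2, F)) = ⊤ →
        (A.card : ℝ) ≤ K ^ C ∨ (Fintype.card SL(2, F) : ℝ) ≤ K ^ C * A.card := by
  obtain ⟨C, hC⟩ := card_dichotomy h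
  refine ⟨((C + 1 : ℕ) : ℝ), by positivity, ?_⟩
  intro F _ _ _ K hK A hA hgen
  have hmono : K ^ C ≤ K ^ ((C + 1 : ℕ) : ℝ) := by
    rw [Real.rpow_natCast]
    exact pow_le_pow_right₀ (by linarith) (Nat.le_succ C)
  rcases hC F K hK A hA hgen with h1 | h1
  · exact Or.inl (h1.trans hmono)
  · exact Or.inr (h1.trans (mul_le_mul_of_nonneg_right hmono (Nat.cast_nonneg _)))

end BreuillardGreenTao2011_SL2

end Literature.GroupTheory.ApproximateGroups
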